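import Mathlib
import HarnessLib
import Summits.HubbardSuperconductivity.HubbardSuperconductivity.Theorems.KLProgrammeKLRegimeEngineFrameShiftMomentDoorFlow
import Summits.HubbardSuperconductivity.HubbardSuperconductivity.Theorems.KLProgrammeKLRegimeEngineFrameShiftMomentReading

/-!
# K3 gen-8-FLOW (stmt 20437 `KLRegimeEngineV17F2`, stub (C)): DOOR (B) READ — the momentum jets of the interpolated, spin/frequency-averaged two-leg
# RESPONSE between the flow frames `K_n` and `K_{n+1}`, in one statement

Cell gate-hubbard-kl, seat p2 g11.  Composition of `…EngineFrameShiftMomentDoorFlow.moment_selfEnergy_flowStep_sub_le` (door (B) on the flow, per frequency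
index and spin) with `…EngineFrameShiftMomentReading.norm_iteratedFDeriv_evalM_symInterp_locReAvg_le` (the reading step): for the averaged data
`f_j(k⃗) = ¼Σ_σ[Re Σ[𝒲_j]((ω₊,k⃗),σ) + Re Σ[𝒲_j]((ω₋,k⃗),σ)]` (`𝒲_j = 𝒢(C^{K_{n+j}}_{>Λ}, V_U)`, any two frequency indices `i₊, i₋` — the reading uses `±ω₀`),

* **`norm_iteratedFDeriv_evalM_symInterp_flowStep_response_le`** —
  `‖Dʲ evalM (symInterp L (f₁ − f₀)) q‖ ≤ 2|β|L²·(12·(2L²(2B₁+1)βL²(2β/Λ)·frameDist K_{n+1} K_n)·N + 2·(21·3ʲ·𝒥)·S²)`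
  under the door hypotheses at every frequency index and spin (`Z_t ≠ 0`; four- and two-leg moments `≤ N`, `≤ S` at weight `(1+|x̃₀|+|x̃₁|)ʲ`; piece tables, fit, `𝒥`).

This is the (B) term of the (P)-shape of stub (C) up to c4a-1's chain rule along `γ_{K_{n+1}}`.  Proofs only; nothing about the sizes is asserted; nothing
asserts superconductivity.  References: BGM 2006 §2.3 (2.17), §3 (3.2)–(3.8) [cite: BenfattoGiulianiMastropietro2006].
-/

noncomputable section

namespace Summit.HubbardSuperconductivity.HubbardSuperconductivity.Theorems.EngineV8

set_option linter.dupNamespace false -- summit = problem name (single-conjunct summit), D-0017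

open Finset Literature.MathematicalPhysics.QuantumLattice Literature.Probability.LatticeModels GrassmannAlgebra Set
open Summit.HubbardSuperconductivity.HubbardSuperconductivity.Theorems.KLRegimeSplit
open scoped Nat

variable {L M : ℕ} [NeZero L] [NeZero M]

/-- **DOOR (B) READ ON THE FLOW FRAMES**: the momentum jets of order `j` of the interpolated, spin/frequency-averaged real part of the two-leg RESPONSE
between `K_n` and `K_{n+1}` are bounded by door (B)'s moment bound (uniform over the two frequency indices and the spins). -/
theorem norm_iteratedFDeriv_evalM_symInterp_flowStep_response_le {B₁ : ℝ} (hB' : ∀ y, |deriv salmhoferCutoff y| ≤ B₁) {β : ℝ} (hβ : 0 < β)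
    {Λ : ℝ} (hΛ : 0 < Λ) (μ U : ℝ) (n : ℕ) {s₀ s₁ : FreqMomentum L M × Fin 2 → ℂ} (hs₀ : s₀ = uvSymbolCT L M β μ (klFlowFrameU L M β U μ n) Λ)
    (hs₁ : s₁ = uvSymbolCT L M β μ (klFlowFrameU L M β U μ (n + 1)) Λ) (ip im : MatsubaraIdx M) (j : ℕ)
    (hZ : ∀ t ∈ Set.Icc (0 : ℝ) 1, effPartitionFn ℂ (normalCovariance L M s₀ + ((t : ℂ)) • (normalCovariance L M s₁ - normalCovariance L M s₀))
      (hubbardInteraction L M β U) ≠ 0)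
    {N S : ℝ}
    (hN : ∀ (i : MatsubaraIdx M) (σ : Fin 2), ∀ t ∈ Set.Icc (0 : ℝ) 1, ∀ A : HubbardFieldIdx L M,
      ∑ x : TorusSite 2 L, (1 + ((x 0).valMinAbs.natAbs : ℝ) + ((x 1).valMinAbs.natAbs : ℝ)) ^ j * ‖torusFourierInv (fun kv : TorusSite 2 L =>
        kernel ℂ (effAction ℂ (normalCovariance L M s₀ + ((t : ℂ)) • (normalCovariance L M s₁ - normalCovariance L M s₀))
          (hubbardInteraction L M β U)) 4
          (Fin.snoc (Fin.snoc ![((((i, kv), σ), 0) : HubbardFieldIdx L M), (((i, kv), σ), 1)] (A.1, 1 - A.2) : Fin 3 → HubbardFieldIdx L M) A)) x‖ ≤ N)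
    (hS : ∀ (i : MatsubaraIdx M) (σ : Fin 2), ∀ t ∈ Set.Icc (0 : ℝ) 1,
      ∑ x : TorusSite 2 L, (1 + ((x 0).valMinAbs.natAbs : ℝ) + ((x 1).valMinAbs.natAbs : ℝ)) ^ j * ‖torusFourierInv (fun kv : TorusSite 2 L =>
        kernel ℂ (effAction ℂ (normalCovariance L M s₀ + ((t : ℂ)) • (normalCovariance L M s₁ - normalCovariance L M s₀))
          (hubbardInteraction L M β U)) 2 ![((((i, kv), σ), 0) : HubbardFieldIdx L M), (((i, kv), σ), 1)]) x‖ ≤ S)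
    {N' : ℕ} {B : ℝ} (hB1 : 1 ≤ B) (hB : ∀ l ≤ N', ∀ t, ‖iteratedDeriv l salmhoferCutoff t‖ ≤ B) (hN' : j + 4 ≤ N')
    {pj : ℕ → ℕ → ℝ} (hpj : ∀ m ≤ n, ∀ j' ≤ j + 2, ∀ q : Momentum, ‖iteratedFDeriv ℝ j' (evalM (klFlowPiece L M β U μ m)) q‖ ≤ pj m j')
    {d : ℝ} (hfit : ∀ (i : MatsubaraIdx M) (j' : ℕ), 1 ≤ j' → j' ≤ j + 2 →
      4 + ∑ m ∈ range n, pj m j' + pj n j' ≤ d * (6 / max |matsubaraFreq β M i| (Λ / 2)) ^ (j' - 1))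
    {J : ℝ}
    (hJ : ∀ (i : MatsubaraIdx M), ∀ k ≤ j + 2, (Real.pi / 2) ^ k * ∑ j' ∈ Finset.range (k + 1), (k.choose j' : ℝ) *
      (j' ! * ((2 * (β * (L : ℝ) ^ 2) * B * (2 / max |matsubaraFreq β M i| (Λ / 2)) ^ 2) * j' !) *
        (max d 1 * (6 / max |matsubaraFreq β M i| (Λ / 2))) ^ j') * pj n (k - j') ≤ J) (q : Momentum) :
    ‖iteratedFDeriv ℝ j (evalM (symInterp L (fun kv : TorusSite 2 L => (∑ σ : Fin 2,
        ((selfEnergy L M β (effAction ℂ (normalCovariance L M s₁) (hubbardInteraction L M β U)) (ip, kv) σ -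
            selfEnergy L M β (effAction ℂ (normalCovariance L M s₀) (hubbardInteraction L M β U)) (ip, kv) σ).re +
          (selfEnergy L M β (effAction ℂ (normalCovariance L M s₁) (hubbardInteraction L M β U)) (im, kv) σ -
            selfEnergy L M β (effAction ℂ (normalCovariance L M s₀) (hubbardInteraction L M β U)) (im, kv) σ).re)) / 4))) q‖ ≤
      2 * (|β| * (L : ℝ) ^ 2) *
        (12 * (2 * (L : ℝ) ^ 2 * ((2 * B₁ + 1) * (β * (L : ℝ) ^ 2)) * (2 * β / Λ) *
            frameDist (klFlowFrameU L M β U μ (n + 1)) (klFlowFrameU L M β U μ n)) * N + 2 * (21 * 3 ^ j * J) * S ^ 2) := by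
  set W₁ := effAction ℂ (normalCovariance L M s₁) (hubbardInteraction L M β U) with hW₁
  set W₀ := effAction ℂ (normalCovariance L M s₀) (hubbardInteraction L M β U) with hW₀
  set Bd : ℝ := 2 * (|β| * (L : ℝ) ^ 2) *
    (12 * (2 * (L : ℝ) ^ 2 * ((2 * B₁ + 1) * (β * (L : ℝ) ^ 2)) * (2 * β / Λ) *
        frameDist (klFlowFrameU L M β U μ (n + 1)) (klFlowFrameU L M β U μ n)) * N + 2 * (21 * 3 ^ j * J) * S ^ 2) with hBd
  -- door (B) on the flow, at each frequency index and spin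
  have hdoor : ∀ (i : MatsubaraIdx M) (σ : Fin 2),
      ∑ x : TorusSite 2 L, (1 + ((x 0).valMinAbs.natAbs : ℝ) + ((x 1).valMinAbs.natAbs : ℝ)) ^ j *
        ‖torusFourierInv (fun kv : TorusSite 2 L => selfEnergy L M β W₁ (i, kv) σ - selfEnergy L M β W₀ (i, kv) σ) x‖ ≤ Bd :=
    fun i σ => moment_selfEnergy_flowStep_sub_le hB' hβ hΛ μ U n hs₀ hs₁ i σ j hZ (hN i σ) (hS i σ) hB1 hB hN' hpj (hfit i) (hJ i)
  -- the reading step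
  have hread := norm_iteratedFDeriv_evalM_symInterp_locReAvg_le (L := L)
    (fun σ (kv : TorusSite 2 L) => selfEnergy L M β W₁ (ip, kv) σ - selfEnergy L M β W₀ (ip, kv) σ)
    (fun σ (kv : TorusSite 2 L) => selfEnergy L M β W₁ (im, kv) σ - selfEnergy L M β W₀ (im, kv) σ) j q
  refine hread.trans ?_
  calc (∑ σ : Fin 2, ((∑ x : TorusSite 2 L, (1 + ((x 0).valMinAbs.natAbs : ℝ) + ((x 1).valMinAbs.natAbs : ℝ)) ^ j *
          ‖torusFourierInv (fun kv : TorusSite 2 L => selfEnergy L M β W₁ (ip, kv) σ - selfEnergy L M β W₀ (ip, kv) σ) x‖) +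
        (∑ x : TorusSite 2 L, (1 + ((x 0).valMinAbs.natAbs : ℝ) + ((x 1).valMinAbs.natAbs : ℝ)) ^ j *
          ‖torusFourierInv (fun kv : TorusSite 2 L => selfEnergy L M β W₁ (im, kv) σ - selfEnergy L M β W₀ (im, kv) σ) x‖))) / 4
      ≤ (∑ _σ : Fin 2, (Bd + Bd)) / 4 := div_le_div_of_nonneg_right (sum_le_sum fun σ _ => add_le_add (hdoor ip σ) (hdoor im σ)) (by norm_num)
    _ = Bd := by rw [sum_const, card_univ, Fintype.card_fin]; ring

end Summit.HubbardSuperconductivity.HubbardSuperconductivity.Theorems.EngineV8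

end
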